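/-
Copyright (c) 2026. Released under Apache 2.0 license as described in the file LICENSE.
Track B ∕ K2-LIT (cell `hodgecm-mathlib`, squad K2, ENGINE E1), crux h413 = `stmt-HodgeConjecture-24833`, route of record `HCCMUnconditional`.
Prover seat `hodgecm-mathlib-K2E3-p12` (g6).  Deal «BL-P1» (K2E1-plan (g5) 08:32:53Z), file P1b: Bernstein–Lapid's Fredholm criterion for local finiteness (Lemma «fred», Cor. «fred2»).
-/
import Literature.Analysis.OperatorTheory.AnalyticFredholm     -- ★ `exists_finiteDimensional_norm_sub_starProjection_comp_le` (compact = finite rank + small, Hilbert space)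
import Mathlib.Analysis.SpecificLimits.Normed
import Mathlib.Analysis.Calculus.FDeriv.Mul
import Mathlib.Analysis.Calculus.FDeriv.CompCLM
import Mathlib.Analysis.Calculus.FDeriv.Prod
import HarnessLib

/-!
# K2·E1 — `K2E1FredholmFiniteTypeCriterion`: BERNSTEIN–LAPID'S FREDHOLM CRITERION [arXiv:1911.02342, §2.4 Lemma + Corollary] — an analytic operator equation `A(s)v = c(s)` whose operator
# at `s₀` is LEFT-INVERTIBLE MODULO COMPACT OPERATORS (Hilbert space) is LOCALLY OF FINITE TYPE near `s₀`, in the column currency of ★ `exists_meromorphic_solution`; direct-sum version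

Track B ∕ K2-LIT, crux h413 = `stmt-HodgeConjecture-24833`, route of record `HCCMUnconditional`; cell `hodgecm-mathlib`, squad K2, ENGINE E1 (campaign EIS-R7-BL-SPH, RULING «RE-WIRE N=3»).
Prover seat `hodgecm-mathlib-K2E3-p12` (g6).  THEOREMS ONLY (no `def`, no `instance`, no notation, no named-fact hypothesis, no `sorry`); lane `--supports stmt-HodgeConjecture-24833 --as helper`
(count-neutral).  Closes no socket.  GENERIC functional analysis — no automorphic content.

THE MATHEMATICS [BernsteinLapid2019, §2.4].  `𝓥` a complex HILBERT space, `𝓦` a normed space, `A : W₀ → 𝓛(𝓥, 𝓦)` holomorphic on an open `W₀ ∋ s₀`, and `D₀A(s₀) = 1 − K` with `K` compact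
(«left-invertible modulo compact operators»).  Reed–Simon VI.13 (★ `exists_finiteDimensional_norm_sub_starProjection_comp_le`): `K = P_VK + K₂`, `dim V < ∞`, `‖K₂‖ ≤ ½`; Neumann:
`S := (1 − K₂)⁻¹`; `D := SD₀` has `DA(s₀) = 1 − F`, `F := SP_VK` of finite rank (range `⊆ S(V)`).  `X(s) := DA(s) + F` is holomorphic with `X(s₀) = 1`, hence invertible on an open
`W ∋ s₀` with `Y(s) := X(s)⁻¹` holomorphic (Mathlib `DifferentiableOn.inverse`, `Units.isOpen`), and for EVERY `v`: `v = Y(s)X(s)v = Y(s)D(A(s)v) + Y(s)Fv` with `Y(s)Fv ∈ span{Y(s)Sb_j}`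
(`b_j` a basis of `V`) — the RESOLVENT IDENTITY §1.  Consequences (§2): if `A(s)v = c(s)` then `v ∈ span{Y(s)Sb_j, Y(s)Dc(s)}` — Lemma «fred» in the INHOMOGENEOUS column form consumed by
★ `exists_meromorphic_solution`'s `hfin`; and on a direct sum `𝓥 × 𝓥₂` with `A(s₀)|_{𝓥}` left-invertible modulo compact and the `𝓥₂`-components of solutions of finite type (columns `τ_k`),
`(v, t) = (v − YDA(v,0), 0) + (YDc, 0) + Σ_k β_k(−YDA(0, τ_k), τ_k)` — Cor. «fred2».
§0 `finiteType_reindex` (any finite index type ⟶ `Fin n`).  §1 **`exists_resolvent_columns`**.  §2 **`locallyFiniteType_of_leftInvertible_modCompact`** (fred), **`locallyFiniteType_prod_of_leftInvertible_modCompact`** (fred2).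
HONEST LABEL: HC_CM is proved only modulo the 7 printed citations (2 remaining named inputs: hLiu418 = `stmt-HodgeConjecture-24832`, h413 = `stmt-HodgeConjecture-24833`) until rung 0
closes; this file asserts no named fact and closes no socket.  Hilbert-space hypothesis on `𝓥` only (finite-rank approximation by orthogonal projection); B–L state Banach.
References: [BernsteinLapid2019] arXiv:1911.02342 (JAMS 37 (2024), doi:10.1090/jams/1020) §2.4 · [ReedSimonI1980] Thm. VI.13 · [Arveson2002] Remark 3.3.3.
-/

set_option autoImplicit false
-- the mandated namespace repeats the single-problem summit's segment (`HodgeConjecture.HodgeConjecture`)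
set_option linter.dupNamespace false

noncomputable section

open Filter Topology Set Submodule Module
open scoped Classical
open Literature.Analysis.OperatorTheory (exists_finiteDimensional_norm_sub_starProjection_comp_le)

namespace Summit.HodgeConjecture.HodgeConjecture.Cruxes.H413.K2E1FredholmFiniteTypeCriterion

/-! ## §0 Re-indexing a finite family of columns by `Fin n` -/

/-- Columns indexed by any finite type give columns indexed by `Fin n` with the same spans (re-index along `Fintype.equivFin`). [folklore] -/
theorem finiteType_reindex {X : Type*} [NormedAddCommGroup X] [NormedSpace ℂ X] {ι : Type*} [Fintype ι] {W : Set ℂ} {s₀ : ℂ} (hW : W ∈ 𝓝 s₀)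
    {e : ι → ℂ → X} (he : ∀ i, DifferentiableOn ℂ (e i) W) {P : ℂ → X → Prop} (hP : ∀ s ∈ W, ∀ x : X, P s x → x ∈ span ℂ (Set.range fun i => e i s)) :
    ∃ W' ∈ 𝓝 s₀, ∃ n : ℕ, ∃ e' : Fin n → ℂ → X, (∀ j, DifferentiableOn ℂ (e' j) W') ∧ ∀ s ∈ W', ∀ x : X, P s x → x ∈ span ℂ (Set.range fun j => e' j s) := by
  refine ⟨W, hW, Fintype.card ι, fun j => e ((Fintype.equivFin ι).symm j), fun j => he _, fun s hs x hx => ?_⟩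
  have h : (Set.range fun j : Fin (Fintype.card ι) => e ((Fintype.equivFin ι).symm j) s) = Set.range fun i => e i s :=
    (Fintype.equivFin ι).symm.surjective.range_comp (fun i => e i s)
  rw [h]
  exact hP s hs x hx

/-! ## §1 The resolvent identity near a point where `A(s₀)` is left-invertible modulo compact operators -/

/-- **RESOLVENT IDENTITY** [BernsteinLapid2019, §2.4, proof of the Lemma].  `𝓥` complex Hilbert, `A` holomorphic on an open `W₀ ∋ s₀` with values in `𝓛(𝓥, 𝓦)`, `D₀A(s₀) = 1 − K`, `K` compact.
Then on an open `W`, `s₀ ∈ W ⊆ W₀`: an operator `D : 𝓦 → 𝓥`, a holomorphic `Y : W → 𝓛(𝓥)` and finitely many vectors `l_j` with `v − Y(s)D(A(s)v) ∈ span{Y(s)l_j}` for EVERY `v ∈ 𝓥`, `s ∈ W`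
(`K = P_VK + K₂`, `‖K₂‖ ≤ ½` ★ Reed–Simon VI.13; `S = (1 − K₂)⁻¹` Neumann; `D = SD₀`, `F = SP_VK`; `X(s) = DA(s) + F`, `X(s₀) = 1`, `Y = X⁻¹`). [cite: BernsteinLapid2019, §2.4] [cite: ReedSimonI1980, Thm. VI.13] -/
theorem exists_resolvent_columns {𝓥 : Type*} [NormedAddCommGroup 𝓥] [InnerProductSpace ℂ 𝓥] [CompleteSpace 𝓥] {𝓦 : Type*} [NormedAddCommGroup 𝓦] [NormedSpace ℂ 𝓦]
    {W₀ : Set ℂ} (hW₀ : IsOpen W₀) {s₀ : ℂ} (hs₀ : s₀ ∈ W₀) {A : ℂ → 𝓥 →L[ℂ] 𝓦} (hA : DifferentiableOn ℂ A W₀)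
    (hleft : ∃ (D₀ : 𝓦 →L[ℂ] 𝓥) (K : 𝓥 →L[ℂ] 𝓥), IsCompactOperator K ∧ D₀.comp (A s₀) = 1 - K) :
    ∃ W : Set ℂ, IsOpen W ∧ s₀ ∈ W ∧ W ⊆ W₀ ∧ ∃ (D : 𝓦 →L[ℂ] 𝓥) (Y : ℂ → 𝓥 →L[ℂ] 𝓥) (n : ℕ) (l : Fin n → 𝓥),
      DifferentiableOn ℂ Y W ∧ ∀ s ∈ W, ∀ v : 𝓥, v - Y s (D (A s v)) ∈ span ℂ (Set.range fun j => Y s (l j)) := by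
  obtain ⟨D₀, K, hK, hD₀⟩ := hleft
  -- `K = P_V K + K₂` with `dim V < ∞`, `‖K₂‖ ≤ 1/2`
  obtain ⟨V, hVfd, hVproj, hKV⟩ := exists_finiteDimensional_norm_sub_starProjection_comp_le hK (by norm_num : (0 : ℝ) < 1 / 2)
  have hK₂ : ‖K - V.starProjection ∘L K‖ < 1 := hKV.trans_lt (by norm_num)
  have hunit : IsUnit (1 - (K - V.starProjection ∘L K)) := isUnit_one_sub_of_norm_lt_one hK₂
  obtain ⟨S, hS⟩ : ∃ S : 𝓥 →L[ℂ] 𝓥, S * (1 - (K - V.starProjection ∘L K)) = 1 := ⟨_, Ring.inverse_mul_cancel _ hunit⟩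
  -- `D := S D₀`, `F := S P_V K`, `D A(s₀) = 1 - F`
  have hDA : (S ∘L D₀) ∘L A s₀ = 1 - S ∘L (V.starProjection ∘L K) := by
    rw [ContinuousLinearMap.comp_assoc, hD₀]
    have h : (1 : 𝓥 →L[ℂ] 𝓥) - K = (1 - (K - V.starProjection ∘L K)) - V.starProjection ∘L K := by abel
    rw [h]
    show S * ((1 - (K - V.starProjection ∘L K)) - V.starProjection ∘L K) = 1 - S * (V.starProjection ∘L K)
    rw [mul_sub, hS]
  -- `X(s) := D A(s) + F`, holomorphic, `X(s₀) = 1`, invertible on an open `W ∋ s₀`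
  obtain ⟨X, hX⟩ : ∃ X : ℂ → 𝓥 →L[ℂ] 𝓥, X = fun s => (S ∘L D₀) ∘L A s + S ∘L (V.starProjection ∘L K) := ⟨_, rfl⟩
  have hXs₀ : X s₀ = 1 := by rw [hX]; show (S ∘L D₀) ∘L A s₀ + S ∘L (V.starProjection ∘L K) = 1; rw [hDA, sub_add_cancel]
  have hXd : DifferentiableOn ℂ X W₀ := by rw [hX]; exact ((differentiableOn_const _).clm_comp hA).add (differentiableOn_const _)
  have hWo : IsOpen (W₀ ∩ X ⁻¹' {x | IsUnit x}) := hXd.continuousOn.isOpen_inter_preimage hW₀ Units.isOpen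
  have hs₀W : s₀ ∈ W₀ ∩ X ⁻¹' {x | IsUnit x} := ⟨hs₀, by show IsUnit (X s₀); rw [hXs₀]; exact isUnit_one⟩
  -- a basis of `V`; the columns `Y(s) S b_j`
  refine ⟨W₀ ∩ X ⁻¹' {x | IsUnit x}, hWo, hs₀W, Set.inter_subset_left, S ∘L D₀, fun s => Ring.inverse (X s), finrank ℂ V,
    fun j => S ((Module.finBasis ℂ V j : V) : 𝓥), (hXd.mono Set.inter_subset_left).inverse fun s hs => hs.2, fun s hs v => ?_⟩
  have hXu : IsUnit (X s) := hs.2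
  -- `v = Y(X v) = Y(D(A v)) + Y(F v)`
  have hXv : X s v = (S ∘L D₀) (A s v) + S (V.starProjection (K v)) := by rw [hX]; rfl
  have hv : v - Ring.inverse (X s) ((S ∘L D₀) (A s v)) = Ring.inverse (X s) (S (V.starProjection (K v))) := by
    have h1 : (Ring.inverse (X s) * X s) v = v := by rw [Ring.inverse_mul_cancel _ hXu]; rfl
    rw [ContinuousLinearMap.mul_def, ContinuousLinearMap.comp_apply, hXv, map_add] at h1
    rw [← sub_eq_iff_eq_add'.2 h1.symm]
  rw [hv]
  -- `P_V (K v) ∈ V = span b` ⟹ `Y S P_V K v ∈ span {Y S b_j}`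
  have hPK : V.starProjection (K v) ∈ V := V.starProjection_apply_mem (K v)
  have hrepr := congrArg (fun x : V => Ring.inverse (X s) (S (x : 𝓥))) ((Module.finBasis ℂ V).sum_repr ⟨V.starProjection (K v), hPK⟩)
  simp only [Submodule.coe_sum, Submodule.coe_smul, map_sum, map_smul] at hrepr
  rw [← hrepr]
  exact Submodule.sum_mem _ fun j _ => Submodule.smul_mem _ _ (subset_span ⟨j, rfl⟩)

/-! ## §2 Lemma «fred» (inhomogeneous column form) and Corollary «fred2» (direct sum) -/

/-- **FREDHOLM'S CRITERION, Lemma «fred»** [BernsteinLapid2019, §2.4] in the inhomogeneous column currency of ★ `exists_meromorphic_solution`: if `A(s₀)` is left-invertible modulo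
compact operators on the complex Hilbert space `𝓥`, then near `s₀` every solution of `A(s)v = c(s)` (`A`, `c` holomorphic) lies in the span of finitely many HOLOMORPHIC columns
(`Y(s)Sb_j` and `Y(s)D c(s)` of §1) — the equation is locally of finite type at `s₀`. [cite: BernsteinLapid2019, §2.4] [cite: ReedSimonI1980, Thm. VI.13] -/
theorem locallyFiniteType_of_leftInvertible_modCompact {𝓥 : Type*} [NormedAddCommGroup 𝓥] [InnerProductSpace ℂ 𝓥] [CompleteSpace 𝓥] {𝓦 : Type*} [NormedAddCommGroup 𝓦]
    [NormedSpace ℂ 𝓦] {W₀ : Set ℂ} (hW₀ : IsOpen W₀) {s₀ : ℂ} (hs₀ : s₀ ∈ W₀) {A : ℂ → 𝓥 →L[ℂ] 𝓦} (hA : DifferentiableOn ℂ A W₀) {c : ℂ → 𝓦} (hc : DifferentiableOn ℂ c W₀)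
    (hleft : ∃ (D₀ : 𝓦 →L[ℂ] 𝓥) (K : 𝓥 →L[ℂ] 𝓥), IsCompactOperator K ∧ D₀.comp (A s₀) = 1 - K) :
    ∃ W ∈ 𝓝 s₀, ∃ n : ℕ, ∃ e : Fin n → ℂ → 𝓥, (∀ j, DifferentiableOn ℂ (e j) W) ∧ ∀ s ∈ W, ∀ v : 𝓥, A s v = c s → v ∈ span ℂ (Set.range fun j => e j s) := by
  obtain ⟨W, hWo, hs₀W, hWW₀, D, Y, n, l, hY, hcore⟩ := exists_resolvent_columns hW₀ hs₀ hA hleft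
  refine finiteType_reindex (ι := Option (Fin n)) (hWo.mem_nhds hs₀W) (e := fun o s => Option.elim o (Y s (D (c s))) fun j => Y s (l j))
    (P := fun s v => A s v = c s) (fun o => ?_) fun s hs v hv => ?_
  · cases o with
    | none => exact hY.clm_apply (D.differentiable.comp_differentiableOn (hc.mono hWW₀))
    | some j => exact hY.clm_apply (differentiableOn_const _)
  · have h := hcore s hs v
    rw [show A s v = c s from hv] at h
    rw [show v = (v - Y s (D (c s))) + Y s (D (c s)) by abel]
    exact add_mem (span_mono (by rintro _ ⟨j, rfl⟩; exact ⟨some j, rfl⟩) h) (subset_span ⟨none, rfl⟩)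

/-- **FREDHOLM'S CRITERION ON A DIRECT SUM, Corollary «fred2»** [BernsteinLapid2019, §2.4]: unknowns in `𝓥 × 𝓥₂` (`𝓥` complex Hilbert), `A(s₀)|_{𝓥}` left-invertible modulo compact
operators, and the `𝓥₂`-components of the solutions of `A(s)x = c(s)` of finite type on `W₀` (holomorphic columns `τ_k`): then the equation is locally of finite type at `s₀` in `𝓥 × 𝓥₂`
(columns `(Y Sb_j, 0)`, `(Y Dc, 0)`, `(−Y D A(0, τ_k), τ_k)`). [cite: BernsteinLapid2019, §2.4] [cite: ReedSimonI1980, Thm. VI.13] -/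
theorem locallyFiniteType_prod_of_leftInvertible_modCompact {𝓥 : Type*} [NormedAddCommGroup 𝓥] [InnerProductSpace ℂ 𝓥] [CompleteSpace 𝓥]
    {𝓥₂ : Type*} [NormedAddCommGroup 𝓥₂] [NormedSpace ℂ 𝓥₂] {𝓦 : Type*} [NormedAddCommGroup 𝓦] [NormedSpace ℂ 𝓦]
    {W₀ : Set ℂ} (hW₀ : IsOpen W₀) {s₀ : ℂ} (hs₀ : s₀ ∈ W₀) {A : ℂ → (𝓥 × 𝓥₂) →L[ℂ] 𝓦} (hA : DifferentiableOn ℂ A W₀) {c : ℂ → 𝓦} (hc : DifferentiableOn ℂ c W₀)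
    (hleft : ∃ (D₀ : 𝓦 →L[ℂ] 𝓥) (K : 𝓥 →L[ℂ] 𝓥), IsCompactOperator K ∧ D₀.comp ((A s₀).comp (ContinuousLinearMap.inl ℂ 𝓥 𝓥₂)) = 1 - K)
    {m : ℕ} {τ : Fin m → ℂ → 𝓥₂} (hτ : ∀ k, DifferentiableOn ℂ (τ k) W₀)
    (hfin₂ : ∀ s ∈ W₀, ∀ x : 𝓥 × 𝓥₂, A s x = c s → x.2 ∈ span ℂ (Set.range fun k => τ k s)) :
    ∃ W ∈ 𝓝 s₀, ∃ n : ℕ, ∃ e : Fin n → ℂ → 𝓥 × 𝓥₂, (∀ j, DifferentiableOn ℂ (e j) W) ∧ ∀ s ∈ W, ∀ x : 𝓥 × 𝓥₂, A s x = c s → x ∈ span ℂ (Set.range fun j => e j s) := by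
  have hA₁ : DifferentiableOn ℂ (fun s => (A s).comp (ContinuousLinearMap.inl ℂ 𝓥 𝓥₂)) W₀ := hA.clm_comp (differentiableOn_const _)
  obtain ⟨W, hWo, hs₀W, hWW₀, D, Y, n, l, hY, hcore⟩ := exists_resolvent_columns hW₀ hs₀ hA₁ hleft
  -- the columns, indexed by `Option (Fin n ⊕ Fin m)`: `none ↦ (Y Dc, 0)`, `inl j ↦ (Y l_j, 0)`, `inr k ↦ (−Y D A(0, τ_k), τ_k)`
  obtain ⟨col, hcol⟩ : ∃ col : Option (Fin n ⊕ Fin m) → ℂ → 𝓥 × 𝓥₂,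
      col none = (fun s => (Y s (D (c s)), (0 : 𝓥₂))) ∧ (∀ j, col (some (Sum.inl j)) = fun s => (Y s (l j), (0 : 𝓥₂))) ∧
      ∀ k, col (some (Sum.inr k)) = fun s => (-(Y s (D (A s (ContinuousLinearMap.inr ℂ 𝓥 𝓥₂ (τ k s))))), τ k s) :=
    ⟨fun o s => match o with
      | none => (Y s (D (c s)), (0 : 𝓥₂))
      | some (Sum.inl j) => (Y s (l j), (0 : 𝓥₂))
      | some (Sum.inr k) => (-(Y s (D (A s (ContinuousLinearMap.inr ℂ 𝓥 𝓥₂ (τ k s))))), τ k s),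
     rfl, fun j => rfl, fun k => rfl⟩
  refine finiteType_reindex (ι := Option (Fin n ⊕ Fin m)) (hWo.mem_nhds hs₀W) (e := col) (P := fun s x => A s x = c s) (fun o => ?_) fun s hs x hx => ?_
  · rcases o with _ | j | k
    · rw [hcol.1]
      exact (hY.clm_apply (D.differentiable.comp_differentiableOn (hc.mono hWW₀))).prodMk (differentiableOn_const _)
    · rw [hcol.2.1 j]
      exact (hY.clm_apply (differentiableOn_const _)).prodMk (differentiableOn_const _)
    · rw [hcol.2.2 k]
      exact (hY.clm_apply (D.differentiable.comp_differentiableOn ((hA.mono hWW₀).clm_apply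
        ((ContinuousLinearMap.inr ℂ 𝓥 𝓥₂).differentiable.comp_differentiableOn ((hτ k).mono hWW₀))))).neg.prodMk ((hτ k).mono hWW₀)
  · -- decompose `A(s)x = A(s)(x.1, 0) + A(s)(0, x.2)` and write `x.2` in the columns `τ_k`
    have hsplit : A s x = A s (ContinuousLinearMap.inl ℂ 𝓥 𝓥₂ x.1) + A s (ContinuousLinearMap.inr ℂ 𝓥 𝓥₂ x.2) := by
      rw [← map_add]; congr 1; ext <;> simp
    have hx₁ : (A s).comp (ContinuousLinearMap.inl ℂ 𝓥 𝓥₂) x.1 = c s - A s (ContinuousLinearMap.inr ℂ 𝓥 𝓥₂ x.2) := by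
      rw [ContinuousLinearMap.comp_apply, eq_sub_iff_add_eq, ← hsplit]; exact hx
    obtain ⟨β, hβ⟩ := (Submodule.mem_span_range_iff_exists_fun ℂ).1 (hfin₂ s (hWW₀ hs) x hx)
    have h1 := hcore s hs x.1
    rw [hx₁, map_sub, map_sub, ← hβ, map_sum, map_sum, map_sum, map_sum] at h1
    simp_rw [map_smul] at h1
    -- `h1 : x.1 - (Y D c - Σ β_k • Y D A(0, τ_k)) ∈ span {Y l_j}`
    have hdecomp : x =
        ((x.1 - (Y s (D (c s)) - ∑ k, β k • Y s (D (A s (ContinuousLinearMap.inr ℂ 𝓥 𝓥₂ (τ k s))))), (0 : 𝓥₂)) : 𝓥 × 𝓥₂) +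
        ((Y s (D (c s)), (0 : 𝓥₂)) : 𝓥 × 𝓥₂) +
        ∑ k, β k • ((-(Y s (D (A s (ContinuousLinearMap.inr ℂ 𝓥 𝓥₂ (τ k s))))), τ k s) : 𝓥 × 𝓥₂) := by
      ext
      · simp only [Prod.fst_add, Prod.fst_sum, Prod.smul_fst, smul_neg, Finset.sum_neg_distrib]
        abel
      · simp only [Prod.snd_add, Prod.snd_sum, Prod.smul_snd, zero_add]
        exact hβ.symm
    have hc0 : col none s = (Y s (D (c s)), (0 : 𝓥₂)) := by rw [hcol.1]
    have hcl : ∀ j, col (some (Sum.inl j)) s = (Y s (l j), (0 : 𝓥₂)) := fun j => by rw [hcol.2.1 j]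
    have hcr : ∀ k, col (some (Sum.inr k)) s = (-(Y s (D (A s (ContinuousLinearMap.inr ℂ 𝓥 𝓥₂ (τ k s))))), τ k s) := fun k => by rw [hcol.2.2 k]
    rw [hdecomp]
    refine add_mem (add_mem ?_ (subset_span ⟨none, hc0⟩)) (Submodule.sum_mem _ fun k _ => Submodule.smul_mem _ _ (subset_span ⟨some (Sum.inr k), hcr k⟩))
    -- the first summand: the `𝓥`-membership of §1 pushed into `𝓥 × {0}`
    have h2 := Submodule.mem_map_of_mem (f := LinearMap.inl ℂ 𝓥 𝓥₂) h1
    rw [← Submodule.span_image] at h2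
    refine span_mono ?_ h2
    rintro _ ⟨_, ⟨j, rfl⟩, rfl⟩
    exact ⟨some (Sum.inl j), hcl j⟩

end Summit.HodgeConjecture.HodgeConjecture.Cruxes.H413.K2E1FredholmFiniteTypeCriterion

end
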